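import Summits.BirchSwinnertonDyer.BirchSwinnertonDyer.Theorems.EisensteinPrimesMazurMCOnCellBTwistbackKrizLiStepL
import Summits.BirchSwinnertonDyer.BirchSwinnertonDyer.Theorems.EisensteinPrimesMazurMCOnCellBTwistbackKrizLiPartner
import Summits.BirchSwinnertonDyer.Rank1Residual.X11b.CastellaErratum
import HarnessLib

/-!
# Crux 3 `MazurMCOnCellB` (stmt-BirchSwinnertonDyer-19033), line `twistback` v4 — the per-pair road into stub 6 at a
# NON-split X2b pair with ONE certificate on the Heegner point: «`P_K ∉ p·E(K)`» replaces BOTH per-pair inputs of the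
# door p645525 §2 that are not published theorems — STEP L (`hlow`, item -27489 / Keller–Yin Thm. D, PREPRINT) and
# the twist's analytic rank (`hrd`)

Width seat bsd-line-x2-p1-w8 g0 (2026-08-28), `--supports stmt-BirchSwinnertonDyer-19033 --as helper`; sequel of
p650223 (`…TwistbackKrizLiStepL`) after the LEAD's caution (bsd-eis STATUS l.3339) and my erratum (l.≈3425): the
Kriz–Li HYPOTHESES of p650223 §3–§4 are unsatisfiable on row A10, but its Kriz–Li-FREE lemmas are not, and they
say that STEP L needs only a `p`-indivisible Heegner point. HONEST FRAMING (cell `bsd-eis`): conditional theorems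
only; inputs BY NAME = the route's `PublishedInputs` (stmt-…-19037: Gross–Zagier, modularity, Cassels, GZK, Wuthrich,
…), Disegni 2020 Thm. 4(1), Greenberg–Vatsal Thm. (3.11) — ALL PUBLISHED — and PER PAIR: one admissible `K`, the
`p`-INDIVISIBILITY of the Heegner point `P_K` in `E(K)` (a finite certificate: the reduction of an explicit `P_K` at one
good prime; NOT supplied here and NOT known class-wide), a Manin constant prime to `p`, and a KL-flat carrier of the
twist (class number + local balance, seats w3 g6–g8). Nothing booked; no main conjecture / BSD proved for any curve
unconditionally; no summit statement is proved; 0 cells / labels / tiers move; no definition, no named fact, no `sorry`.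

## What is proved

* §1 `not_isOfFinAddOrder_of_forall_nsmul_ne` (pure algebra: in a group without `p`-torsion an element that is no
  `p`-th multiple has infinite order — torsion of order prime to `p` is `p`-divisible) and
  `indexLowerBoundAt_of_forall_nsmul_ne`: at a NON-split multiplicative `p ≥ 3` (so `E(K)[p] = 0` for every
  `K ↪ ℚ_p`, p650223 §2), **`∀ Q, p • Q ≠ P` ⟹ `P` has infinite order, `p ∤ [E(K) : ℤP]` and
  `X11b.IndexLowerBoundAt W p K P`** (left side `0`).
* §2 `analyticRank_twist_eq_one_of_forall_nsmul_ne`: for `W` of analytic rank `0`, `K` imaginary quadratic Heegner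
  for `N_W` with `p` split, and a Heegner point `P` of level `N_W` that is no `p`-th multiple:
  `ord_{s=1} L(E^{(d_K)}, s) = 1` — seat w6's `…KrizLiPartner.analyticRank_twist_eq_one_of_isHeegnerPoint_of_not_isOfFinAddOrder`
  (Gross–Zagier + modularity) after §1.
* §3 `mazurMainConjectureAt_of_cellB_of_not_split_of_forall_nsmul_ne_of_klFlat_twist` — **the door p645525 §2 with
  `hlow` AND `hrd` DISCHARGED by the single per-pair hypothesis `hprim : ∀ Q : E(K), p • Q ≠ P`**: Mazur's main
  conjecture at a NON-split X2b pair `(W, p)` ⟸ `PublishedInputs` + Disegni Thm. 4(1) + GV Thm. (3.11) + ONE Heegner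
  datum `(N = N_W, K, Dt, H, ι, P)` with `d_K` odd `< −4`, `p ∤ Dt.c`, `P` `p`-indivisible in `E(K)` + a KL-flat carrier
  of a minimal model of the twist. NO preprint, NO analytic-rank hypothesis, NO `p`-adic `L`-function of a curve.
* §4 `upperPartner_at_of_forall_nsmul_ne_of_klFlat_partner` — the `(W, p)`-instance of stub 6 (∃-PARTNER, VERBATIM
  shape) from the same datum: p645525 §3 with `hr1` discharged by §2.

Why `P_K ∉ p·E(K)` is the right certificate (and when it can hold): by Gross–Zagier + BSD over `K` the index satisfies
`[E(K):ℤP_K]² ≐ #Ш(E/K) · ∏_ℓ c_ℓ(E)²` up to `p`-units (`u_K = 1`, Manin, `#E(K)_tors` prime to `p`), so the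
certificate is expected exactly on the pairs with `p ∤ #Ш(E/K) · ∏ c_ℓ(E)` — there STEP L (`2·ord_p index ≤
ord_p #Ш + 2·ord_p ∏ c_ℓ`) is the trivial `0 ≤ …`; on the other pairs item -27489 remains the road. Whether any
of the 30 local-balance-`1` cells of A10 (lam-a CA-g9-1) has such a partner is a census question, not answered here.

References: [JetchevSkinnerWan2017] §7.1 (7.1.5), §7.4.1 (eq:shalowerK-1) (arXiv:1512.06894 pp. 16, 30);
[Castella2018] proof of Thm. 2.3 (calcul), (1.1); [GrossZagier1986] Thm. I.(6.3), V.§2, I.§7; [SilvermanAEC2009]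
VII.6.1, Ex. 3.5; [GreenbergVatsal2000] §3 Thm. (3.11), §2 p. 28; [Disegni2020] Thm. 4 (§3.2); [Wuthrich2014] Thm. 16.
-/

set_option autoImplicit false
-- `Summit.BirchSwinnertonDyer.BirchSwinnertonDyer.…`: the summit and its single sub-problem share a name.
set_option linter.dupNamespace false

noncomputable section

open scoped Classical MatrixGroups ModularForm

open CongruenceSubgroup WeierstrassCurve NumberField IsDedekindDomain Field
  Literature.NumberTheory.EllipticCurves Literature.NumberTheory.GaloisRepresentations
  Literature.NumberTheory.EllipticCurves.ModularForms Literature.NumberTheory.EllipticCurves.Rank1Residual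
  Literature.NumberTheory.EllipticCurves.Rank1Residual.Typed Literature.NumberTheory.EllipticCurves.Wuthrich2014
  Literature.NumberTheory.EllipticCurves.GreenbergVatsal2000 Literature.NumberTheory.EllipticCurves.Disegni2020
  Summit.BirchSwinnertonDyer.Rank1Residual Summit.BirchSwinnertonDyer.BirchSwinnertonDyer.Theses
  Summit.BirchSwinnertonDyer.BirchSwinnertonDyer.Theorems.EisensteinPrimesMazurMCOnCellBTwistbackKLFlatPartner
  Summit.BirchSwinnertonDyer.BirchSwinnertonDyer.Theorems.EisensteinPrimesMazurMCOnCellBTwistbackKrizLiStepL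

namespace Summit.BirchSwinnertonDyer.BirchSwinnertonDyer.Theorems.EisensteinPrimesMazurMCOnCellBTwistbackIndivisiblePartner

/-! ## §1. A `p`-indivisible point in a group without `p`-torsion: infinite order, index prime to `p`, STEP L -/

section Algebra

/-- **Torsion of order prime to `p` is `p`-divisible**: in an abelian group without `p`-torsion, an element that is
no `p`-th multiple has infinite order (`X11b.LocalIndex.coprime_addOrderOf` + `mem_range_nsmul_pow_of_coprime`).
[folklore] -/
theorem not_isOfFinAddOrder_of_forall_nsmul_ne {A : Type*} [AddCommGroup A] {p : ℕ} [Fact p.Prime]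
    (hA : ∀ R : A, p • R = 0 → R = 0) {P : A} (hprim : ∀ Q : A, p • Q ≠ P) : ¬ IsOfFinAddOrder P := by
  intro hfin
  obtain ⟨Q, hQ⟩ := X11b.LocalIndex.mem_range_nsmul_pow_of_coprime (p := p) 1 hfin
    (X11b.LocalIndex.coprime_addOrderOf hA hfin)
  exact hprim Q (by simpa [pow_one] using hQ)

end Algebra

section StepL

variable (W : WeierstrassCurve ℚ) [W.IsElliptic] [W.IsGloballyMinimal] (p : ℕ) [Fact p.Prime]
  {K : Type} [Field K] [NumberField K]

/-- **STEP L from ONE certificate.** For `W/ℚ` globally minimal, `p ≥ 3` NON-split multiplicative, a number field `K`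
with an embedding `ι_p : K → ℚ_p`, and `P ∈ E(K)` that is no `p`-th multiple in `E(K)`: `P` has infinite order,
`p ∤ [E(K) : ℤP]`, and JSW's (eq:shalowerK-1) / Castella's (1.1) `X11b.IndexLowerBoundAt W p K P` holds with left
side `0` (`E(K)[p] = 0` by p650223's `nsmul_eq_zero_imp_eq_zero_of_not_split`; Cauchy in `E(K)/ℤP` by
`O5…padicValNat_index_zmultiples_eq_zero`). No Ш, no Tamagawa number, no main conjecture, no `p`-adic logarithm.
[cite: JetchevSkinnerWan2017, §7.4.1 (eq:shalowerK-1) (arXiv:1512.06894 p. 30)] [cite: SilvermanAEC2009, Thm VII.6.1 and Exercise 3.5] -/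
theorem indexLowerBoundAt_of_forall_nsmul_ne (hp3 : 3 ≤ p) (hmult : W.HasMultiplicativeReductionAtPrime p)
    (hns : ¬ W.HasSplitMultiplicativeReductionAtPrime p) (ιp : K →+* ℚ_[p])
    (P : (W.baseChange K).toAffine.Point) (hprim : ∀ Q : (W.baseChange K).toAffine.Point, p • Q ≠ P) :
    ¬ IsOfFinAddOrder P ∧ padicValNat p (AddSubgroup.zmultiples P).index = 0 ∧ X11b.IndexLowerBoundAt W p K P := by
  have htors := nsmul_eq_zero_imp_eq_zero_of_not_split W p hp3 hmult hns ιp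
  have hidx : padicValNat p (AddSubgroup.zmultiples P).index = 0 :=
    O5.HeegnerLogTransport.padicValNat_index_zmultiples_eq_zero htors hprim
  exact ⟨not_isOfFinAddOrder_of_forall_nsmul_ne htors hprim, hidx,
    indexLowerBoundAt_of_padicValNat_index_eq_zero W p K P hidx⟩

end StepL

/-! ## §2. The twist's analytic rank from the same certificate (Gross–Zagier + modularity; seat w6's lemma) -/

section Rank

/-- **`ord_{s=1} L(E^{(d_K)}, s) = 1` from a `p`-indivisible Heegner point.** `W/ℚ` globally minimal with
`ord_{s=1} L(E, s) = 0` and NON-split multiplicative reduction at `p ≥ 3`; `K` imaginary quadratic with the Heegner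
hypothesis for `N_W` and `p` split (two primes above `p`); `P ∈ E(K)` a Heegner point of level `N_W` that is no `p`-th
multiple in `E(K)`. Then `P` has infinite order (§1, along the embedding `K ↪ K_𝔭 = ℚ_p` at a degree-one prime,
`X11b.embAt`) and seat w6's `…KrizLiPartner.analyticRank_twist_eq_one_of_isHeegnerPoint_of_not_isOfFinAddOrder`
(Gross–Zagier `gross_zagier N_W W K` + modularity `exists_isNewformOf`) gives the twist's analytic rank.
[cite: GrossZagier1986, Thm. I.(6.3) with V.§2 and I.§7] [cite: Gross1991, (1.1)] -/
theorem analyticRank_twist_eq_one_of_forall_nsmul_ne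
    (W : WeierstrassCurve ℚ) [W.IsElliptic] [W.IsGloballyMinimal] (p : ℕ) [Fact p.Prime]
    (K : Type) [Field K] [NumberField K] [NeZero (W.conductorNorm ℤ)]
    (hGZ : gross_zagier (W.conductorNorm ℤ) W K) (hnf : exists_isNewformOf)
    (hp3 : 3 ≤ p) (hmult : W.HasMultiplicativeReductionAtPrime p) (hns : ¬ W.HasSplitMultiplicativeReductionAtPrime p)
    (hK : IsImaginaryQuadratic K) (hH : SatisfiesHeegnerHypothesis (W.conductorNorm ℤ) K)
    (hsplit : X11b.SplitsIn K p) (hr0 : W.analyticRank = 0)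
    {P : (W.baseChange K).toAffine.Point} (hP : IsHeegnerPoint (W.conductorNorm ℤ) W K P)
    (hprim : ∀ Q : (W.baseChange K).toAffine.Point, p • Q ≠ P) :
    (W.quadraticTwist (NumberField.discr K : ℚ)).analyticRank = 1 := by
  obtain ⟨𝔭, h𝔭, he, hf⟩ := X11b.exists_degreeOnePrime_of_splitsIn K p hK.1 hsplit
  have hnt := (indexLowerBoundAt_of_forall_nsmul_ne W p hp3 hmult hns (X11b.embAt K p 𝔭 h𝔭 he hf) P hprim).1
  exact EisensteinPrimesMazurMCOnCellBTwistbackKrizLiPartner.analyticRank_twist_eq_one_of_isHeegnerPoint_of_not_isOfFinAddOrder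
    W K hGZ hnf hK hH hr0 hP hnt

end Rank

/-! ## §3. PER PAIR, NON-SPLIT X2b: Mazur's MC from ONE indivisibility certificate and a KL-flat partner -/

section Door

/-- **PER PAIR, NON-SPLIT: Mazur's main conjecture at an X2b pair from a `p`-INDIVISIBLE HEEGNER POINT and a KL-flat
partner.** The LEAD's door p645525 §2
(`…KLFlatPartner.mazurMainConjectureAt_of_cellB_of_not_split_of_indexLowerBoundAt_of_klFlat_twist`) VERBATIM except
that BOTH per-pair inputs that are not published theorems — STEP L `hlow : Finite Ш(E/K) → X11b.IndexLowerBoundAt W p K P`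
(item -27489 / Keller–Yin Thm. D) and the twist's analytic rank `hrd : Wd.analyticRank = 1` — are REPLACED by the single
hypothesis `hprim : ∀ Q : E(K), p • Q ≠ P` on the Heegner point of the datum (§1: `E(K)[p] = 0` at a non-split `p ≥ 3`,
so `P` is of infinite order and `p ∤ [E(K) : ℤP]`, STEP L with left side `0`; §2: Gross–Zagier + modularity give
`ord_{s=1} L(E^{(d_K)}, s) = 1`, moved to the minimal model `Wd` by `analyticRank_smul`). Inputs BY NAME:
`PublishedInputs` (GZ, modularity, …), Disegni Thm. 4(1), GV Thm. (3.11) — ALL PUBLISHED; per pair: the Heegner datum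
with `d_K` odd `< −4` and `p ∤ Dt.c`, the certificate `hprim`, and a KL-flat carrier isogenous to `Wd`. BSD / MC proved
for no curve unconditionally; `hprim` is NOT known class-wide (it fails wherever `p ∣ #Ш(E/K)·∏ c_ℓ`).
[cite: JetchevSkinnerWan2017, §7.4.1 (eq:shalowerK-1)] [cite: GrossZagier1986, Thm. I.(6.3) with V.§2]
[cite: GreenbergVatsal2000, §3 Thm. (3.11) (p. 43) and §2 p. 28] [cite: Disegni2020, Thm. 4 (§3.2)] [cite: Wuthrich2014, Thm. 16 (p. 397)] -/
theorem mazurMainConjectureAt_of_cellB_of_not_split_of_forall_nsmul_ne_of_klFlat_twist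
    (hP : EisensteinPrimes.PublishedInputs) (hDis : padicBSD_rankOne_nonsplitMult)
    (h311 : thm311_hasUnitContent_iff_and_order_eq_of_lineRamifiedEven)
    (W : WeierstrassCurve ℚ) [W.IsElliptic] [W.IsGloballyMinimal] (p : ℕ) [Fact p.Prime]
    (hc : X2.CellB W p) (hns : ¬ W.HasSplitMultiplicativeReductionAtPrime p)
    (N : ℕ) [NeZero N] (K : Type) [Field K] [NumberField K]
    (Dt : ModularParametrizationData W N) (H : HeegnerDatum N (NumberField.discr K)) (ι : K →+* ℂ)
    (P : (W.baseChange K).toAffine.Point)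
    (hK : IsImaginaryQuadratic K) (hodd : Odd (NumberField.discr K)) (hlt : NumberField.discr K < -4)
    (hN : W.conductorNorm ℤ = N) (hHN : SatisfiesHeegnerHypothesis N K)
    (hHp : SatisfiesHeegnerHypothesis p K)
    (hPt : WeierstrassCurve.Affine.Point.map ι.toRatAlgHom P = heegnerPointComplex Dt H)
    (hcM : ¬ (p : ℤ) ∣ Dt.c)
    -- the ONE certificate on the Heegner point (replaces `hlow` and `hrd`)
    (hprim : ∀ Q : (W.baseChange K).toAffine.Point, p • Q ≠ P)
    (Wd : WeierstrassCurve ℚ) [Wd.IsElliptic] [Wd.IsGloballyMinimal]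
    (hWd : ∃ C : VariableChange ℚ, C • Wd = W.quadraticTwist (NumberField.discr K : ℚ))
    -- the KL-flat carrier of the twist (verbatim from the door)
    (V' : WeierstrassCurve ℚ) [V'.IsElliptic] [V'.IsGloballyMinimal] (hiso : IsIsogenous Wd V')
    (S₀ : Finset (HeightOneSpectrum (𝓞 ℚ))) (Φ₀ : AddSubgroup (V'.geomTorsion (p : ℤ)))
    (m : ℕ) [NeZero m] (φ : DirichletCharacter (ZMod p) m)
    (d : ℕ) [NeZero d] (ψ : DirichletCharacter (ZMod p) d)
    (hΦ : IsRationalLine V' p Φ₀) (hram : ¬ LineUnramifiedAt V' p Φ₀) (heven : LineEven V' p Φ₀)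
    (hφ : φ.IsPrimitive) (hψ : ψ.IsPrimitive) (hpm : p ∣ m) (hpd : ¬ p ∣ d)
    (hφ0 : ∀ (σ : absoluteGaloisGroup ℚ), ∀ Q ∈ Φ₀,
      σ • Q = (φ ((modNCyclotomicCharacter ℚ m σ : (ZMod m)ˣ) : ZMod m)).val • Q)
    (hψ0 : ∀ (σ : absoluteGaloisGroup ℚ) (Q : V'.geomTorsion (p : ℤ)),
      σ • Q - (ψ ((modNCyclotomicCharacter ℚ d σ : (ZMod d)ˣ) : ZMod d)).val • Q ∈ Φ₀)
    (hS₀p : ∀ v ∈ S₀, ((p : ℕ) : 𝓞 ℚ) ∉ v.asIdeal)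
    (hS : ∀ v : HeightOneSpectrum (𝓞 ℚ), v ∉ S₀ → ((p : ℕ) : 𝓞 ℚ) ∉ v.asIdeal → V'.HasGoodReductionAt v)
    (hC1 : ‖characterLValueC p φ ∅ 1‖ = 1) (hD1 : ‖characterLValueD p ψ ∅ 1‖ = 1)
    (hbal : 1 + ∑ v ∈ S₀, delta V' p v =
      ∑ v ∈ S₀, ((if φ (Rat.HeightOneSpectrum.natGenerator v : ZMod m) =
            (Rat.HeightOneSpectrum.natGenerator v : ZMod p)
          then sFactor p (Rat.HeightOneSpectrum.natGenerator v) else 0) +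
        (if ψ (Rat.HeightOneSpectrum.natGenerator v : ZMod d) =
            (Rat.HeightOneSpectrum.natGenerator v : ZMod p)
          then sFactor p (Rat.HeightOneSpectrum.natGenerator v) else 0))) :
    X2.MazurMainConjectureAt W p := by
  have hnf := hP.2.2.2.2.2.1
  have hGZ := hP.2.2.2.2.2.2.2.2.1
  have hp : p.Prime := Fact.out
  have hp2 : p ≠ 2 := hc.2.1.1
  have hp3 : 3 ≤ p := by
    rcases hp.eq_two_or_odd' with h | ⟨k, hk⟩
    · exact absurd h hp2
    · have := hp.two_le; omega
  have hmult : W.HasMultiplicativeReductionAtPrime p := hc.2.1.2.2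
  have hsplit : X11b.SplitsIn K p := hHp p hp (dvd_refl p)
  obtain ⟨𝔭, h𝔭, he, hf⟩ := X11b.exists_degreeOnePrime_of_splitsIn K p hK.1 hsplit
  -- STEP L at the datum, left side `0`
  have hlow : Finite (W.baseChange K).sha → X11b.IndexLowerBoundAt W p K P := fun _ ↦
    (indexLowerBoundAt_of_forall_nsmul_ne W p hp3 hmult hns (X11b.embAt K p 𝔭 h𝔭 he hf) P hprim).2.2
  -- the twist's analytic rank
  have hr1 : (W.quadraticTwist (NumberField.discr K : ℚ)).analyticRank = 1 := by
    subst hN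
    exact analyticRank_twist_eq_one_of_forall_nsmul_ne W p K (hGZ _ W K) hnf hp3 hmult hns hK hHN hsplit hc.1
      ⟨Dt, H, ι, hPt⟩ hprim
  have hrd : Wd.analyticRank = 1 := by
    obtain ⟨C, hC⟩ := hWd
    have h := congrArg WeierstrassCurve.analyticRank hC
    rw [analyticRank_smul] at h
    exact h.trans hr1
  exact mazurMainConjectureAt_of_cellB_of_not_split_of_indexLowerBoundAt_of_klFlat_twist hP hDis h311 W p hc
    hns N K Dt H ι P hK hodd hlt hN hHN hHp hPt hcM Wd hWd hrd hlow V' hiso S₀ Φ₀ m φ d ψ hΦ hram heven hφ hψ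
    hpm hpd hφ0 hψ0 hS₀p hS hC1 hD1 hbal

end Door

/-! ## §4. The `(W, p)`-instance of stub 6 (∃-PARTNER) from the same datum -/

section Partner

/-- **Stub 6's conclusion AT ONE X2b pair (VERBATIM shape) from a `p`-indivisible Heegner point and KL-flat carriers**:
the LEAD's p645525 §3 `upperPartner_at_of_klFlat_partner` with its analytic-rank input `hr1` DISCHARGED by §2 — so at a
NON-split X2b pair `(W, p)` the partner clause of `stub_upperPartner` holds with the field `K` of ONE Heegner datum
`(N = N_W, K, Dt, H, ι, P)` (`d_K` odd `< −4`, Heegner for `N_W` and `p`) whose point is no `p`-th multiple in `E(K)`,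
given a KL-flat carrier for every minimal model of the twist. Inputs BY NAME: `PublishedInputs` (GZ, modularity, …),
Disegni Thm. 4(1), GV Thm. (3.11). No summit statement; BSD / MC proved for no curve unconditionally.
[cite: GrossZagier1986, Thm. I.(6.3) with V.§2] [cite: GreenbergVatsal2000, §3 Thm. (3.11) (p. 43) and §2 p. 28]
[cite: Disegni2020, Thm. 4 (§3.2)] [cite: Wuthrich2014, Thm. 16 (p. 397)] -/
theorem upperPartner_at_of_forall_nsmul_ne_of_klFlat_partner (hP : EisensteinPrimes.PublishedInputs)
    (hDis : padicBSD_rankOne_nonsplitMult) (h311 : thm311_hasUnitContent_iff_and_order_eq_of_lineRamifiedEven)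
    (W : WeierstrassCurve ℚ) [W.IsElliptic] [W.IsGloballyMinimal] (p : ℕ) [Fact p.Prime]
    (hc : X2.CellB W p) (hns : ¬ W.HasSplitMultiplicativeReductionAtPrime p)
    (N : ℕ) [NeZero N] (K : Type) [Field K] [NumberField K]
    (Dt : ModularParametrizationData W N) (H : HeegnerDatum N (NumberField.discr K)) (ι : K →+* ℂ)
    (P : (W.baseChange K).toAffine.Point)
    (hK : IsImaginaryQuadratic K) (hN : W.conductorNorm ℤ = N)
    (hHN : SatisfiesHeegnerHypothesis N K) (hHp : SatisfiesHeegnerHypothesis p K)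
    (hodd : Odd (NumberField.discr K)) (hlt : NumberField.discr K < -4)
    (hPt : WeierstrassCurve.Affine.Point.map ι.toRatAlgHom P = heegnerPointComplex Dt H)
    (hprim : ∀ Q : (W.baseChange K).toAffine.Point, p • Q ≠ P)
    (hKL : ∀ (Wd : WeierstrassCurve ℚ) [Wd.IsElliptic] [Wd.IsGloballyMinimal],
      (∃ C : VariableChange ℚ, C • Wd = W.quadraticTwist (NumberField.discr K : ℚ)) →
      ∃ (V' : WeierstrassCurve ℚ) (_ : V'.IsElliptic) (_ : V'.IsGloballyMinimal), IsIsogenous Wd V' ∧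
        ∃ (S₀ : Finset (HeightOneSpectrum (𝓞 ℚ))) (Φ₀ : AddSubgroup (V'.geomTorsion (p : ℤ)))
          (m : ℕ) (_ : NeZero m) (φ : DirichletCharacter (ZMod p) m)
          (d : ℕ) (_ : NeZero d) (ψ : DirichletCharacter (ZMod p) d),
          IsRationalLine V' p Φ₀ ∧ ¬ LineUnramifiedAt V' p Φ₀ ∧ LineEven V' p Φ₀ ∧
          φ.IsPrimitive ∧ ψ.IsPrimitive ∧ p ∣ m ∧ ¬ p ∣ d ∧
          (∀ (σ : absoluteGaloisGroup ℚ), ∀ Q ∈ Φ₀,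
            σ • Q = (φ ((modNCyclotomicCharacter ℚ m σ : (ZMod m)ˣ) : ZMod m)).val • Q) ∧
          (∀ (σ : absoluteGaloisGroup ℚ) (Q : V'.geomTorsion (p : ℤ)),
            σ • Q - (ψ ((modNCyclotomicCharacter ℚ d σ : (ZMod d)ˣ) : ZMod d)).val • Q ∈ Φ₀) ∧
          (∀ v ∈ S₀, ((p : ℕ) : 𝓞 ℚ) ∉ v.asIdeal) ∧
          (∀ v : HeightOneSpectrum (𝓞 ℚ), v ∉ S₀ → ((p : ℕ) : 𝓞 ℚ) ∉ v.asIdeal →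
            V'.HasGoodReductionAt v) ∧
          ‖characterLValueC p φ ∅ 1‖ = 1 ∧ ‖characterLValueD p ψ ∅ 1‖ = 1 ∧
          1 + ∑ v ∈ S₀, delta V' p v =
            ∑ v ∈ S₀, ((if φ (Rat.HeightOneSpectrum.natGenerator v : ZMod m) =
                  (Rat.HeightOneSpectrum.natGenerator v : ZMod p)
                then sFactor p (Rat.HeightOneSpectrum.natGenerator v) else 0) +
              (if ψ (Rat.HeightOneSpectrum.natGenerator v : ZMod d) =
                  (Rat.HeightOneSpectrum.natGenerator v : ZMod p)
                then sFactor p (Rat.HeightOneSpectrum.natGenerator v) else 0))) :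
    ∃ (K : Type) (_ : Field K) (_ : NumberField K), IsImaginaryQuadratic K ∧
      SatisfiesHeegnerHypothesis (W.conductorNorm ℤ) K ∧ SatisfiesHeegnerHypothesis p K ∧
      Odd (NumberField.discr K) ∧ NumberField.discr K < -4 ∧
      (W.quadraticTwist (NumberField.discr K : ℚ)).analyticRank = 1 ∧
      ∀ (Wd : WeierstrassCurve ℚ) [Wd.IsElliptic] [Wd.IsGloballyMinimal],
        (∃ C : VariableChange ℚ, C • Wd = W.quadraticTwist (NumberField.discr K : ℚ)) →
        MissingUpperBoundAt Wd p := by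
  have hnf := hP.2.2.2.2.2.1
  have hGZ := hP.2.2.2.2.2.2.2.2.1
  have hp : p.Prime := Fact.out
  have hp2 : p ≠ 2 := hc.2.1.1
  have hp3 : 3 ≤ p := by
    rcases hp.eq_two_or_odd' with h | ⟨k, hk⟩
    · exact absurd h hp2
    · have := hp.two_le; omega
  have hmult : W.HasMultiplicativeReductionAtPrime p := hc.2.1.2.2
  have hsplit : X11b.SplitsIn K p := hHp p hp (dvd_refl p)
  subst hN
  have hr1 : (W.quadraticTwist (NumberField.discr K : ℚ)).analyticRank = 1 :=
    analyticRank_twist_eq_one_of_forall_nsmul_ne W p K (hGZ _ W K) hnf hp3 hmult hns hK hHN hsplit hc.1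
      ⟨Dt, H, ι, hPt⟩ hprim
  exact upperPartner_at_of_klFlat_partner hP hDis h311 W p hc hns K hK hHN hHp hodd hlt hr1 hKL

end Partner

end Summit.BirchSwinnertonDyer.BirchSwinnertonDyer.Theorems.EisensteinPrimesMazurMCOnCellBTwistbackIndivisiblePartner

end
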